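import Mathlib
import Summits.Ventures.PercRepro2.Defs
import Summits.Ventures.PercRepro2.Independence
import Summits.Ventures.PercRepro2.Harris
import Summits.Ventures.PercRepro2.Graph
import Summits.Ventures.PercRepro2.Exploration
import Summits.Ventures.PercRepro2.Events
import Summits.Ventures.PercRepro2.RBDefs

/-!
# The Rao–Blackwell chain: revealing one more cluster never raises the between-cluster
covariance (blind cell PercRepro2, typer-1; mine-a g3 MINE-A.md §18 "CONJECTURED GENERAL FORM …
W = ∅ trivial, W ∋ marked vertex = BHK", INBOX 15:26:16Z "the monotone chain
`0 = Cov_∅ ≥ Cov_{a₃} ≥ Cov_{a₃,a₄} ≥ … ≥ Cov_{all} = BHK` is a COROLLARY of row 2′RB … by the law of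
total covariance; the typed chain theorem `cov_revealed_antitone` … typer-sized once RB_all is a Prop")

**State maps.** A revealment is a map `σ : Config E → α` (`α` finite); its atoms `{σ = x}` are the
events of the σ-algebra `𝓖_σ`. The cleared Rao–Blackwell sum
`rbSumState σ X Y = Σ_x P(Q ∩ {σ = x} ∩ X) P(Q ∩ {σ = x} ∩ Y) / P(Q ∩ {σ = x}) = P(Q) · E_π[X̂_σ Ŷ_σ]`
(`X̂_σ = μ(X | 𝓖_σ)`) generalises `RB.rbSum` (`σ = C(w)`, `rbSumState_cluster`) and, for the trivial
state, is `P(Q ∩ X) P(Q ∩ Y) / P(Q) = P(Q) · μ(X) μ(Y)` (`rbSumState_unit`). Since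
`P(Q)·Cov_π(X̂_σ, Ŷ_σ) = rbSumState σ X Y − P(Q ∩ X) P(Q ∩ Y) / P(Q)`, comparing two revealments is
comparing their `rbSumState`.

**The step** (law of total covariance on the atoms of `σ`): if on every atom `{σ = x}` the
single-map Rao–Blackwell inequality for `τ` holds (`RBcrossOn σ τ X Y`: the conditional version of
(RB-cross) given `σ = x` — mine-a: on a hole state this is (RB-cross) on the residual graph), then
`rbSumState (σ, τ) ≤ rbSumState σ` (`rbSumState_pair_le`); (RB-same) gives `≥` (`rbSumState_le_pair`).
`RBcross` itself is `RBcrossOn` for the trivial state (`RBcross_iff_RBcrossOn_unit`).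

**Revealed clusters.** `revealState ends W ω = (C(w))_{w ∈ W}`; `covRevealed W = rbSumState (revealState W)`;
`revealState (insert w W)` is the pair `(revealState W, C(w))` up to the equivalence
`(↥(insert w W) → Set V) ≃ (↥W → Set V) × Set V` (`covRevealed_insert_eq`, via `rbSumState_comp_equiv`),
so the per-atom hypothesis gives **`covRevealed_insert_le`** (cross) / **`covRevealed_le_insert`** (same):
`Cov_{𝓖_{W ∪ {w}}} ≤ Cov_{𝓖_W}` resp. `≥` — mine-a's `cov_revealed_antitone`, with the per-atom
(RB-cross) on the hole states as the hypothesis. What is NOT in this file: that the per-atom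
hypothesis follows from `RB_all` applied to the residual graph of the hole state (the domain Markov
transport) — that bridge is the open content of the chain beyond row 2′RB itself.
-/

namespace Summit.Ventures.PercRepro2

namespace RB

open scoped Classical

variable {V : Type*} {E : Type*} [Fintype E] [DecidableEq E] [Fintype V] [DecidableEq V]
  {R : Type*} [Field R] [LinearOrder R] [IsStrictOrderedRing R]

/-! ## Rao–Blackwell sums over the atoms of a state map -/

section State

variable (p : E → R) (ends : E → Sym2 V) (s t : V)

/-- `rbSumState σ X Y = Σ_x P(Q ∩ {σ = x} ∩ X) · P(Q ∩ {σ = x} ∩ Y) / P(Q ∩ {σ = x})`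
(`= P(Q) · E_π[X̂_σ Ŷ_σ]`), the Rao–Blackwell sum over the atoms of the state map `σ`. -/
noncomputable def rbSumState {α : Type*} [Fintype α] (σ : Config E → α) (X Y : Set (Config E)) : R :=
  ∑ x : α, prob p (Qst ends s t ∩ {ω | σ ω = x} ∩ X) * prob p (Qst ends s t ∩ {ω | σ ω = x} ∩ Y) /
    prob p (Qst ends s t ∩ {ω | σ ω = x})

/-- **The per-atom (RB-cross) hypothesis**: on every atom `{σ = x}`, the Rao–Blackwell sum of the
refinement by `τ` is at most the atom's own term. -/
def RBcrossOn {α β : Type*} [Fintype α] [Fintype β] (σ : Config E → α) (τ : Config E → β)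
    (X Y : Set (Config E)) : Prop :=
  ∀ x : α,
    (∑ y : β, prob p (Qst ends s t ∩ {ω | σ ω = x} ∩ {ω | τ ω = y} ∩ X) *
        prob p (Qst ends s t ∩ {ω | σ ω = x} ∩ {ω | τ ω = y} ∩ Y) /
      prob p (Qst ends s t ∩ {ω | σ ω = x} ∩ {ω | τ ω = y})) ≤
    prob p (Qst ends s t ∩ {ω | σ ω = x} ∩ X) * prob p (Qst ends s t ∩ {ω | σ ω = x} ∩ Y) /
      prob p (Qst ends s t ∩ {ω | σ ω = x})

/-- **The per-atom (RB-same) hypothesis** (the reverse inequality). -/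
def RBsameOn {α β : Type*} [Fintype α] [Fintype β] (σ : Config E → α) (τ : Config E → β)
    (X Y : Set (Config E)) : Prop :=
  ∀ x : α,
    prob p (Qst ends s t ∩ {ω | σ ω = x} ∩ X) * prob p (Qst ends s t ∩ {ω | σ ω = x} ∩ Y) /
      prob p (Qst ends s t ∩ {ω | σ ω = x}) ≤
    ∑ y : β, prob p (Qst ends s t ∩ {ω | σ ω = x} ∩ {ω | τ ω = y} ∩ X) *
        prob p (Qst ends s t ∩ {ω | σ ω = x} ∩ {ω | τ ω = y} ∩ Y) /
      prob p (Qst ends s t ∩ {ω | σ ω = x} ∩ {ω | τ ω = y})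

omit [Fintype E] [DecidableEq E] [Fintype V] [DecidableEq V] [LinearOrder R] [IsStrictOrderedRing R] in
/-- The atoms of the pair `(σ, τ)` are the intersections of the atoms. -/
lemma atom_pair_eq {α β : Type*} (σ : Config E → α) (τ : Config E → β) (x : α) (y : β) :
    {ω | (σ ω, τ ω) = (x, y)} = {ω | σ ω = x} ∩ {ω | τ ω = y} := by
  ext ω
  simp only [Set.mem_setOf_eq, Set.mem_inter_iff, Prod.mk.injEq]

omit [Fintype V] [DecidableEq V] in
/-- **Law of total covariance, cross form**: refining `σ` by `τ` lowers the Rao–Blackwell sum when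
(RB-cross) holds on every atom of `σ`. -/
theorem rbSumState_pair_le {α β : Type*} [Fintype α] [Fintype β] (σ : Config E → α)
    (τ : Config E → β) (X Y : Set (Config E)) (h : RBcrossOn p ends s t σ τ X Y) :
    rbSumState p ends s t (fun ω => (σ ω, τ ω)) X Y ≤ rbSumState p ends s t σ X Y := by
  unfold rbSumState
  rw [Fintype.sum_prod_type]
  refine Finset.sum_le_sum fun x _ => ?_
  refine le_trans (le_of_eq ?_) (h x)
  refine Finset.sum_congr rfl fun y _ => ?_
  rw [atom_pair_eq]
  simp only [Set.inter_assoc]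

omit [Fintype V] [DecidableEq V] in
/-- **Law of total covariance, same form**: refining `σ` by `τ` raises the Rao–Blackwell sum when
(RB-same) holds on every atom of `σ`. -/
theorem rbSumState_le_pair {α β : Type*} [Fintype α] [Fintype β] (σ : Config E → α)
    (τ : Config E → β) (X Y : Set (Config E)) (h : RBsameOn p ends s t σ τ X Y) :
    rbSumState p ends s t σ X Y ≤ rbSumState p ends s t (fun ω => (σ ω, τ ω)) X Y := by
  unfold rbSumState
  rw [Fintype.sum_prod_type]
  refine Finset.sum_le_sum fun x _ => ?_
  refine le_trans (h x) (le_of_eq ?_)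
  refine Finset.sum_congr rfl fun y _ => ?_
  rw [atom_pair_eq]
  simp only [Set.inter_assoc]

omit [Fintype V] [DecidableEq V] [LinearOrder R] [IsStrictOrderedRing R] in
/-- The Rao–Blackwell sum is invariant under relabelling the states by an equivalence. -/
theorem rbSumState_comp_equiv {α β : Type*} [Fintype α] [Fintype β] (σ : Config E → α) (e : α ≃ β)
    (X Y : Set (Config E)) :
    rbSumState p ends s t (fun ω => e (σ ω)) X Y = rbSumState p ends s t σ X Y := by
  unfold rbSumState
  rw [← Fintype.sum_equiv e _ _ (fun x => rfl)]
  refine Finset.sum_congr rfl fun x _ => ?_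
  have : {ω | e (σ ω) = e x} = {ω | σ ω = x} := by
    ext ω
    simp only [Set.mem_setOf_eq, e.injective.eq_iff]
  rw [this]

omit [Fintype V] [DecidableEq V] [LinearOrder R] [IsStrictOrderedRing R] in
/-- The trivial revealment: `rbSumState (fun _ => ()) X Y = P(Q ∩ X) P(Q ∩ Y) / P(Q)`. -/
lemma rbSumState_unit (X Y : Set (Config E)) :
    rbSumState p ends s t (fun _ : Config E => ()) X Y =
      prob p (Qst ends s t ∩ X) * prob p (Qst ends s t ∩ Y) / prob p (Qst ends s t) := by
  unfold rbSumState
  rw [Fintype.sum_unique]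
  have : {ω : Config E | () = ()} = Set.univ := by ext ω; simp
  rw [this, Set.inter_univ]

omit [DecidableEq V] [LinearOrder R] [IsStrictOrderedRing R] in
/-- The revealment by the cluster of `w` is `RB.rbSum`. -/
lemma rbSumState_cluster (w : V) (X Y : Set (Config E)) :
    rbSumState p ends s t (fun ω => cluster ends ω w) X Y = rbSum p ends s t w X Y := rfl

omit [DecidableEq V] [IsStrictOrderedRing R] in
/-- **(RB-cross) is the per-atom hypothesis for the trivial state** (the first step of the chain). -/
theorem RBcross_iff_RBcrossOn_unit (o b w : V) :
    RBcross p ends o b s t w ↔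
      RBcrossOn p ends s t (fun _ : Config E => ()) (fun ω => cluster ends ω w)
        (connEvent ends b s) (connEvent ends o t) := by
  unfold RBcross RBcrossOn rbSum
  simp only [Set.setOf_true, Set.inter_univ]
  constructor
  · intro h _; exact h
  · intro h; exact h ()

omit [DecidableEq V] [IsStrictOrderedRing R] in
/-- **(RB-same) is the per-atom hypothesis for the trivial state**. -/
theorem RBsame_iff_RBsameOn_unit (o b w : V) :
    RBsame p ends o b s t w ↔
      RBsameOn p ends s t (fun _ : Config E => ()) (fun ω => cluster ends ω w)
        (connEvent ends b s) (connEvent ends o s) := by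
  unfold RBsame RBsameOn rbSum
  simp only [Set.setOf_true, Set.inter_univ]
  constructor
  · intro h _; exact h
  · intro h; exact h ()

end State

/-! ## Revealed clusters of a vertex set -/

section Revealed

variable (p : E → R) (ends : E → Sym2 V) (s t : V)

/-- The revealed clusters of `W`: `ω ↦ (C(w))_{w ∈ W}`. -/
def revealState (W : Finset V) (ω : Config E) : ↥W → Set V := fun w => cluster ends ω w

/-- `covRevealed W X Y = P(Q) · E_π[X̂_W Ŷ_W]`, the Rao–Blackwell sum over the revealed clusters of
`W` (`= P(Q) · (Cov_{𝓖_W} + μ(X) μ(Y))`). -/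
noncomputable def covRevealed (W : Finset V) (X Y : Set (Config E)) : R :=
  rbSumState p ends s t (revealState ends W) X Y

omit [Fintype E] [DecidableEq E] [Fintype V] in
/-- Revealing `insert w W` is revealing `W` together with `C(w)`, up to the equivalence
`(↥(insert w W) → Set V) ≃ (↥W → Set V) × Set V`. -/
lemma revealState_insert (W : Finset V) {w : V} (hw : w ∉ W) (ω : Config E) :
    (((Finset.subtypeInsertEquivOption hw).arrowCongr (Equiv.refl (Set V))).trans
        (Equiv.piOptionEquivProd.trans (Equiv.prodComm _ _))) (revealState ends (insert w W) ω) =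
      (revealState ends W ω, cluster ends ω w) := by
  rfl

omit [LinearOrder R] [IsStrictOrderedRing R] in
/-- `covRevealed (insert w W) = rbSumState (revealState W, C(w))`. -/
theorem covRevealed_insert_eq (W : Finset V) {w : V} (hw : w ∉ W) (X Y : Set (Config E)) :
    covRevealed p ends s t (insert w W) X Y =
      rbSumState p ends s t (fun ω => (revealState ends W ω, cluster ends ω w)) X Y := by
  unfold covRevealed
  rw [← rbSumState_comp_equiv p ends s t (revealState ends (insert w W))
    (((Finset.subtypeInsertEquivOption hw).arrowCongr (Equiv.refl (Set V))).trans
        (Equiv.piOptionEquivProd.trans (Equiv.prodComm _ _)))]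
  rfl

/-- **The chain step, cross form** (mine-a's `cov_revealed_antitone`): if (RB-cross) for `C(w)` holds
on every atom of the revealed clusters of `W`, then `Cov_{𝓖_{W ∪ {w}}} ≤ Cov_{𝓖_W}` (cleared by
`P(Q)`: `covRevealed (insert w W) ≤ covRevealed W`). -/
theorem covRevealed_insert_le (W : Finset V) {w : V} (hw : w ∉ W) (X Y : Set (Config E))
    (h : RBcrossOn p ends s t (revealState ends W) (fun ω => cluster ends ω w) X Y) :
    covRevealed p ends s t (insert w W) X Y ≤ covRevealed p ends s t W X Y := by
  rw [covRevealed_insert_eq p ends s t W hw]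
  exact rbSumState_pair_le p ends s t _ _ X Y h

/-- **The chain step, same form**: (RB-same) on every atom gives `Cov_{𝓖_{W ∪ {w}}} ≥ Cov_{𝓖_W}`. -/
theorem covRevealed_le_insert (W : Finset V) {w : V} (hw : w ∉ W) (X Y : Set (Config E))
    (h : RBsameOn p ends s t (revealState ends W) (fun ω => cluster ends ω w) X Y) :
    covRevealed p ends s t W X Y ≤ covRevealed p ends s t (insert w W) X Y := by
  rw [covRevealed_insert_eq p ends s t W hw]
  exact rbSumState_le_pair p ends s t _ _ X Y h

omit [LinearOrder R] [IsStrictOrderedRing R] in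
/-- The chain starts at the trivial revealment: `covRevealed ∅ X Y = P(Q ∩ X) P(Q ∩ Y) / P(Q)`
(`Cov_∅ = 0`). -/
lemma covRevealed_empty (X Y : Set (Config E)) :
    covRevealed p ends s t ∅ X Y =
      prob p (Qst ends s t ∩ X) * prob p (Qst ends s t ∩ Y) / prob p (Qst ends s t) := by
  unfold covRevealed
  rw [← rbSumState_unit p ends s t X Y,
    ← rbSumState_comp_equiv p ends s t (revealState ends ∅)
      (Equiv.equivPUnit (↥(∅ : Finset V) → Set V)).symm.symm]

end Revealed

end RB

end Summit.Ventures.PercRepro2
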